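/-
Origin: expansion seat `planner-pub-hodgecm-qw8-g3-0`, handover #2 2026-08-18T05:11:59Z (`HOME/pub-hodgecm-qw8-g3/Qw8g3/CorCMEndStateGeometric.lean`, md5 e3cfd448, 78 lines);
landed by the gen-6 packager in gate run 22 as `HodgeCM/Assembly/CorCMEndStateGeometric.lean` (import ^import Qw8g[0-9]+\.→import HodgeCM.StubTree. ×1; stripped 1 trailing import-line comments).
-/
/-
Copyright (c) 2026. All rights reserved.
Released under Apache 2.0 license as described in the file LICENSE.
Origin: expansion seat `planner-pub-hodgecm-qw8-g3-0` (unit pub-hodgecm-qw8-g3, [QW8] §2.5 holder, generation 3).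
Proposed place: `HodgeCM/Assembly/CorCMEndStateGeometric.lean` (module `HodgeCM.Assembly.CorCMEndStateGeometric`).
OPTIONAL convenience file (nothing new is proved).  Imports: the landed `HodgeCM.Assembly.CorCMEndStateFacts` (pohl-g3, run 22)
and ONE WIP module of this seat, `Qw8g3.Qw8MilneZero`, to be rewritten `HodgeCM.StubTree.Qw8MilneZero` at intake; lands AFTER it.
-/
import Summits.HodgeConjecture.HodgeCM.StubTree.Qw8MilneZero
import Summits.HodgeConjecture.HodgeCM.Assembly.CorCMEndStateFacts

set_option autoImplicit false

/-!
# The end state with the [QW8] triple `Qw8ExtProd ∧ Qw8DualPushPull ∧ Qw8Milne` replaced by the standard facts F2, F4–F7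

`CorCMEndStateFacts.lean` (pohl-g3, run 22) records the three end-state theorems in the cone
`HC_CM ⇐ ModelAxioms ∧ N1–N4 ∧ Qw8ExtProd ∧ Qw8DualPushPull ∧ Qw8Milne ∧ <theta inputs> ∧ Fact_hodgeRiemann20`.
Since `qw8ExtProd_of_facts`, `qw8DualPushPull_of_facts` (run 21, `StubTree/Qw8Geometric.lean`) and `qw8Milne_of_facts`
(this seat, `StubTree/Qw8MilneZero.lean`, all degrees) the [QW8] triple is a THEOREM of `ModelAxioms`, N1–N4 and the standard facts
F2 `Fact_factorActDescends`, F4 `Fact_cupAlg`, F5 `Fact_cupAssoc`, F6 `Fact_weightDual`, F7 `Fact_gysin`; this file records the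
three end states in the cone

  `HC_CM ⇐ ModelAxioms ∧ N1 ∧ N2 ∧ N3 ∧ N4 ∧ F2 ∧ F4 ∧ F5 ∧ F6 ∧ F7 ∧ <theta inputs> ∧ Fact_hodgeRiemann20`

— no Pohlmann, no Milne, no [QW8] binder — under one name each (`COR_CM_endState_geometric`, `_hecke_geometric`, `_ball_geometric`).
-/

noncomputable section

namespace HodgeCM
namespace Assembly

open Universe

variable (U : Universe)

/-- **COR-CM, end state, geometric-fact form**: as `COR_CM_endState_of_facts` with F2, F4–F7 in place of
`Qw8ExtProd`, `Qw8DualPushPull`, `Qw8Milne`. -/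
theorem COR_CM_endState_geometric (M : U.ModelAxioms) (hN1 : U.Fact_cupExterior) (hN2 : U.Fact_cup_hodge)
    (hN3 : U.Fact_pull_H0) (hN4 : U.Fact_hodge_F0) (h2 : U.Fact_factorActDescends) (h4 : U.Fact_cupAlg)
    (h5 : U.Fact_cupAssoc) (h6 : U.Fact_weightDual) (h7 : U.Fact_gysin)
    (T : U.ThetaModel) (A : T.Inputs) (hHR : U.Fact_hodgeRiemann20) : U.HC_CM :=
  COR_CM_endState_of_facts U M hN1 hN2 hN3 hN4 (U.qw8ExtProd_of_facts M h2 h4 h5 h6 h7)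
    (U.qw8DualPushPull_of_facts M h2 h4 h5 h6 h7) (U.qw8Milne_of_facts M hN1 hN2 hN3 hN4 h2 h4 h5 h6 h7) T A hHR

/-- **END STATE, Hecke route, geometric-fact form**: as `COR_CM_endState_hecke_of_facts` with F2, F4–F7 in place of the
[QW8] triple. -/
theorem COR_CM_endState_hecke_geometric (M : U.ModelAxioms) (hN1 : U.Fact_cupExterior) (hN2 : U.Fact_cup_hodge)
    (hN3 : U.Fact_pull_H0) (hN4 : U.Fact_hodge_F0) (h2 : U.Fact_factorActDescends) (h4 : U.Fact_cupAlg)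
    (h5 : U.Fact_cupAssoc) (h6 : U.Fact_weightDual) (h7 : U.Fact_gysin)
    (T : U.ThetaModel) {Hk : U.HeckeData} (hH : T.HeckeInputs Hk) (hS : T.Open_supply)
    (h₁ : T.Fact_embCover) (h₂ : T.Fact_innerEmb) (h₃ : T.Design_kappaConj) (h₄ : T.Design_frameSignConj)
    (h₅ : T.Open_thetaSub) (h₇ : T.Open_thetaGen12) (h₈ : T.Open_thetaReal34) (h₉ : T.Open_chars)
    (h₁₀ : T.Open_occ) (hHR : U.Fact_hodgeRiemann20) : U.HC_CM :=
  COR_CM_endState_hecke_of_facts U M hN1 hN2 hN3 hN4 (U.qw8ExtProd_of_facts M h2 h4 h5 h6 h7)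
    (U.qw8DualPushPull_of_facts M h2 h4 h5 h6 h7) (U.qw8Milne_of_facts M hN1 hN2 hN3 hN4 h2 h4 h5 h6 h7) T hH hS
    h₁ h₂ h₃ h₄ h₅ h₇ h₈ h₉ h₁₀ hHR

/-- **END STATE, ball route, geometric-fact form**: as `COR_CM_endState_ball_of_facts` with F2, F4–F7 in place of the
[QW8] triple. -/
theorem COR_CM_endState_ball_geometric (M : U.ModelAxioms) (hN1 : U.Fact_cupExterior) (hN2 : U.Fact_cup_hodge)
    (hN3 : U.Fact_pull_H0) (hN4 : U.Fact_hodge_F0) (h2 : U.Fact_factorActDescends) (h4 : U.Fact_cupAlg)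
    (h5 : U.Fact_cupAssoc) (h6 : U.Fact_weightDual) (h7 : U.Fact_gysin)
    (T : U.ThetaModel)
    (B : ∀ {L : CMField} {ι₁ : L →+* ℂ} (V : HermSpace3 L ι₁) (c : SeesawCtx L), U.BallData V c)
    (hB : T.BallInputs B) (hS : T.Open_supply)
    (h₁ : T.Fact_embCover) (h₂ : T.Fact_innerEmb) (h₃ : T.Design_kappaConj) (h₄ : T.Design_frameSignConj)
    (h₅ : T.Open_thetaSub) (h₇ : T.Open_thetaGen12) (h₈ : T.Open_thetaReal34) (h₉ : T.Open_chars)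
    (h₁₀ : T.Open_occ) (hHR : U.Fact_hodgeRiemann20) : U.HC_CM :=
  COR_CM_endState_ball_of_facts U M hN1 hN2 hN3 hN4 (U.qw8ExtProd_of_facts M h2 h4 h5 h6 h7)
    (U.qw8DualPushPull_of_facts M h2 h4 h5 h6 h7) (U.qw8Milne_of_facts M hN1 hN2 hN3 hN4 h2 h4 h5 h6 h7) T B hB hS
    h₁ h₂ h₃ h₄ h₅ h₇ h₈ h₉ h₁₀ hHR

end Assembly
end HodgeCM

end
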